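import Literature.NumberTheory.EllipticCurves.CastellaGrossiLeeSkinner2022.IMC2DivisibilityAndBDPValueFrame
import Literature.NumberTheory.EllipticCurves.KellerYin2024.PotentiallyGoodOrdinaryPConverse
import HarnessLib

/-!
# Keller–Yin (arXiv:2402.12781v2), Theorem D (= Thm. 5.1.3, `imc mult`): the anticyclotomic main
# conjecture `Char(𝔛_f)Λ^nr = (𝓛_f)` at an ODD Eisenstein prime `p ‖ N` of MULTIPLICATIVE reduction,
# and Theorem E (= Thm. 4.1.1 + Cor. 5.2.2): the `p`-converse at a semistable Eisenstein prime —
# the elliptic-curve cases, as explicitly labelled OPEN hypotheses (UNREFEREED PREPRINT)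

HONEST FRAMING (cell `bsd-littype`, seat `bsd-littype-05`; cross-ladder LITERATURE-TYPING layer,
D-0088(4): typed ≠ proved ≠ endorsed). T. Keller, M. Yin, *On the anticyclotomic Iwasawa theory of
newforms at Eisenstein primes of semistable reduction*, arXiv:2402.12781v2 (2024-10-30) is an
UNREFEREED PREPRINT ("part of MY's forthcoming Ph.D. thesis", §0.9). Nothing in this file is a theorem about elliptic curves: the two `def … : Prop` below
TRANSCRIBE, for an elliptic curve over `ℚ` (the case `k = 2`, `ℤ[f] = ℤ`, `𝒪 = ℤ_p`, `A_f = E` of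
the printed statements about newforms / simple RM abelian varieties), the Introduction's
**Theorem D** (TeX label `C`, restating Thm. 5.1.3 `imc mult`; arXiv v1: "Theorem 4") and
**Theorem E** (TeX label `B`, restating Thm. 4.1.1 `p converse` and Cor. 5.2.2 `p converse mult`),
each with the suffix `_OPEN` and the tag `[claim: KellerYin2024, status: under-review]` (D-0012), to be
taken as explicit hypotheses `(h : KellerYin2024.…_OPEN)`; everything else is PROVED bookkeeping.
Companions: Theorem A read at `𝟙` (`thm308_imc2_bdpValue_goodLattice_OPEN`), Theorem C
(`thm421_pPart_OPEN`), Thm. 3.0.10 (`thm3010_…_OPEN`), sequel Thm. 0.1.2 (`thm012_…`), Theorem B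
(`HeegnerPointMainConjecture.lean`).

## The source, verbatim (v2 TeX of record `run/shared/lean/pub/bsd-eis/lit/src/ky24-v2/main.tex`,
## PDF pages from `…/PAGEMAP-v2.md`; arXiv v1 = store text `paper:arxiv-2402.12781`, chunked)

* **Theorem D** (§0.1, TeX L306–L309, v2 PDF p. 5; v1 "Theorem 4", p. 4): "Let `f` be a newform of
  weight `2` and `p ‖ N` an odd Eisenstein prime of multiplicative reduction. Let `K` be an imaginary
  quadratic field satisfying the hypotheses in §0.1. Then the following equation holds in `Λ^nr`:
  `Char(𝔛_f)Λ^nr = (𝓛_f)`." = **Thm. 5.1.3** (`imc mult`, L1771–L1773, PDF p. 44): "`Char(𝔛_f)Λ^nr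
  = (𝓛_f) ⊆ Λ^nr`." §0.1 (L233–L235): "`K/ℚ` a Heegner field for `N`, i.e., an imaginary quadratic
  field such that all primes dividing `N` split completely in `K` … `D_K` is odd and `≠ −3`, and
  `p = v v̄` splits in `K`"; §5 (L1718–L1722): `f ∈ S_2(Γ_0(N))` newform, `p ≠ 2`, `ρ̄_f` reducible,
  `p ‖ N`; §5.1 (L1725–L1735): `𝔛_f := H¹_{𝓕_nr}(K, M_f)^∨`, the dual of the UNRAMIFIED Selmer group
  (relaxed at `v`, unramified at `v̄` and at `w ∤ p`), `Λ = 𝒪⟦T⟧`, `Λ^nr = Λ ⊗̂ ℤ_p^nr`, `𝓛_f` the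
  BDP `p`-adic `L`-function (§5.1 (b): via "[Cas20, Theorem 2.11] which works for Eisenstein
  primes"). Printed proof (L1735–L1780): Hida family of good ordinary members (a)–(e) after [Ski14,
  §3.1], IMC2 (Thm. 3.0.8) for the members, `μ = 0` (Lemma 5.1.1), `λ`-equality (Thm. 1.5.1), a
  Fitting-ideal limit (Lemma 5.1.2), primitive/imprimitive comparisons (Thm. 2.2.2, [Kri16, Prop.
  37]). Remark after Thm. D (L311): "our Main Conjecture would yield both rank `0` and rank `1` BSD
  formulae at multiplicative primes provided the results in [CGS] are extended to higher weight
  modular forms" (v1 p0004 L41: "a rank `1` BSD formula").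
* **Theorem E** (§0.3, TeX L330–L338, v2 PDF p. 6): "Let `A/ℚ` be a simple RM abelian variety
  associated to a newform `f` and `𝔓 ∣ p > 2` a prime ideal of its endomorphism ring `𝒪` of good
  ordinary or bad multiplicative reduction such that `ρ_{A,𝔓}` is reducible. Then `corank_𝒪
  Sel_{𝔓^∞}(A/ℚ) = r ∈ {0,1} ⟹ rk_𝒪 A(ℚ) = r_an(f) = r`, and `Ш(A/ℚ)[𝔓^∞]` is finite." =
  **Thm. 4.1.1** (`p converse`, L1664–L1672, PDF p. 41; "of good reduction") + **Cor. 5.2.2**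
  (`p converse mult`, L1794–L1802, PDF p. 45; "of multiplicative reduction"). Printed proofs:
  Thm. 4.1.1 — "[CGLS, Theorem 5.2.1] … replac[ing] [Mon96, Theorem 1.5] by [Nek18, Theorem C] and
  [CGLS, Corollary 4.2.3] by our (IMC1)" (L1674–L1676); Cor. 5.2.2 — "the proof of [Cas24, Theorem
  1.1] for multiplicative primes and a control theorem of Greenberg ([Cas24, Theorem 3.4]), where the
  appeal to Theorem 1.3 from loc. cit. is replaced by Thm. 5.2.1" (L1803–L1805); [Cas24] =
  Castella, arXiv:2409.01360, a preprint.

## Transcription (tree vocabulary only; nothing re-declared)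

Theorem D — binder for binder the layout of the PUBLISHED good-reduction sibling
`CastellaGrossiLeeSkinner2022.proofThm422_exists_isBDPLFunction_isTorsion_charIdeal_dvd` (same
objects; KY "directly adopt the notations and the arguments from [CGLS]", §3 L1481) and of the
irreducible multiplicative sibling `Castella2018.erratumThm11_exists_isBDPLFunction_isTorsion_charIdeal_eq_OPEN`:
* `f` weight `2`, `ℤ[f] = ℤ` — `W/ℚ` globally minimal, `f` its newform of level `N = N_W`
  (`IsNewformOf W f`, `W.conductorNorm ℤ = N`); "`p ‖ N` odd … multiplicative" — `2 < p`, `Mult W p`;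
  "Eisenstein" — `Red W p`. `K` — `IsImaginaryQuadratic K`, (Heeg) `SatisfiesHeegnerHypothesis N K`,
  (disc) `Odd (discr K)`, `discr K ≠ -3`, (spl) `((p)).primesOver (𝓞 K)).ncard = 2` (implied by (Heeg)
  as `p ∣ N`; kept because printed). `v` induced by the embedding datum `ι'`, `vbar ∋ p` the other
  prime; `κ` THE anticyclotomic `ℤ_p`-extension with topological generator `γ` (`1 + T ↔ γ`),
  `Λ = IwasawaAlgebra p`, `Λ^nr = R₀⟦T⟧ = UnrSeries p`.
* `𝔛_f` — `AcSelmer.XAc (W.baseChange K) p κ vbar ∅ γ`, the GREENBERG dual (relaxed at `v`, strict at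
  `v̄`, trivial at `w ∤ p`; Castella 2018 Def. 2.2 / CGLS §1.4) — the SAME object the CGLS sibling and
  `thm308_imc2_bdpValue_goodLattice_OPEN` use for KY's `𝓕_nr`-dual, by KY's own identification of
  characteristic ideals: "the equivalence is done with the Greenberg Selmer groups, but they generate
  the same characteristic ideals as the unramified Selmer group do" (L1633–L1634), "since
  `ker(res_{M_f})` is finite by Lemma 1.3.6, these two Selmer groups generate the same characteristic
  ideals" (L1704–L1706). FLAG `KYD-Sel`: both sentences sit in the good-reduction sections; at
  `p ‖ N` the identification is part of this transcription ("Thm. 1.5.1, whose proof still works in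
  the multiplicative reduction setting", proof of Thm. 5.1.3).
* "`Char(𝔛_f)Λ^nr = (𝓛_f)`" — a frame `(Ω_K ≠ 0, Ω_p ∈ R₀ˣ, L ∈ R₀⟦T⟧)` with `IsBDPLFunction ι' v κ γ
  f Ω_K Ω_p L` (Castella's normalisation, `ε_p = 0` read off `p ∣ N`), quantified EXISTENTIALLY (the
  currency of every BDP fact of the tree; weaker than the statement about THE `𝓛_f` once it has the
  frame's interpolation property — FLAG `KYD-frame`: at `p ‖ N` KY take `𝓛_f` from [Cas20, Thm. 2.11]
  without re-printing an interpolation formula), `𝔛_f` `Λ`-torsion (FLAG `KYD-tors`: implicit in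
  print — `Char` of a f.g. `Λ`-module; KY Lemma 5.1.1 / Thm. 1.4.1), and, along THE structure map
  `j : ℤ_p → R₀`, the EQUALITY `(Char_Λ 𝔛).map j = (L)` in `R₀⟦T⟧`. Invariant under `L ↦ U·L`.
-- TODO(general form): Thm. D for a weight-2 newform `f` with arbitrary `ℤ[f]` and `𝔭 ∣ p` of `𝒪`
-- (`Λ = 𝒪⟦T⟧`), once `𝔛_f`, `𝓛_f` exist in Literature for `GL₂`-type `A_f`; here `A_f = E`.

Theorem E — the shape of the sibling `p`-converse facts (`CastellaGrossiLeeSkinner2022.thmE_…`,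
PUBLISHED, good non-anomalous; `KellerYin2024.thm012_…`, arXiv:2410.23241, potentially good
ordinary): `W/ℚ` globally minimal elliptic (every atom is model-independent), `2 < p`, "good ordinary
or bad multiplicative" — `Good W p ∨ Mult W p` (Thm. 4.1.1 prints "of good reduction"; at an
Eisenstein `p > 2` good is ordinary, §0.1 L228, tree theorem `Rank1Residual.goodOrd_of_red_of_good`),
"`ρ_{A,𝔓}` is reducible" — read, as everywhere in the paper (§0.1 "Eisenstein prime … the mod-`𝔭`
residual Galois representation … is reducible"), as RESIDUAL reducibility `Red W p`; `r = 0 ∨ r = 1`,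
`W.selmerCorank p = r`; conclusion `W.analyticRank = r`. The clauses "`rk_𝒪 A(ℚ) = r`", "`Ш(A/ℚ)[𝔓^∞]`
finite" are Gross–Zagier–Kolyvagin on `r_an = r ≤ 1` — NOT folded into the fact but PROVED below from
the tree's (GZK) fact `rank_eq_analyticRank_of_analyticRank_le_one`, as in both siblings.
-- TODO(general form): Thm. E for simple RM abelian varieties of `GL₂`-type and `𝔓 ∣ p` of `End(A)`
-- (`corank_𝒪`, `rk_𝒪`), once `𝒪`-Selmer coranks of such `A` exist in Literature.

## Flags for the registry / D-audit (nothing hidden)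

* `KYD-Sel`, `KYD-frame`, `KYD-tors` — above (object / ∃-frame / torsion conjunct).
* `KYD-gap` (PROOF, not statement): the tree holds a kernel-checked counterexample (`T` vs `T − p`
  over `ℤ_p⟦T⟧`) to the inference printed at v2 L1754 ("since the `μ`-invariants are `0`, `λ(𝔛^S_f)`
  … determines `𝔛^S_{f,free}/𝔭^m` … Thus `(Fitt(𝔛^S_{f,free}), 𝔭^m) = (Fitt(𝔛^S_{f_m,free}), 𝔭^m)`"):
  `Summit.BirchSwinnertonDyer.Rank1Residual.X2.KellerYinFreePartGap.span_X_sup_sq_ne_span_X_sub_C_sup_sq`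
  (cell `bsd-eis`), with a repaired congruence-limit argument whose one non-algebraic input — lattice
  congruences `T_{f_m}/ϖ^m ≅ T_f/ϖ^m` for residually REDUCIBLE `f` — is not in print. The STATEMENT
  below is Theorem D verbatim; its printed proof has this located gap (PREPRINT, gapped-as-printed).
* `KYE-Cas24`: Cor. 5.2.2's printed proof rests on Castella arXiv:2409.01360 (preprint) Thms. 1.1,
  3.4 and on KY Thm. 5.2.1 (`multHg`, the Heegner point main conjecture at `p ‖ N`, NOT transcribed:
  its `Λ`-adic Heegner class `𝐳_∞^*` at `p ‖ N` — "a derived Heegner class `𝐳'_∞` defined by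
  `𝐳_∞ = (γ − 1)𝐳'_∞` in the split multiplicative case", L1785–L1787 — has no Literature object; the
  tree's `HeegnerFamily` is printed to exist for `p ∤ N` only, `HeegnerModuleIndex.lean`).

## Contents (all in `namespace Literature.NumberTheory.EllipticCurves.KellerYin2024`)

* `thmD_imcMult_exists_isBDPLFunction_isTorsion_charIdeal_eq_OPEN` — Theorem D (ONE new `Prop`);
  PROVED: `…_charIdeal_le_of_thmD_OPEN` (one-sided form `Char·R₀⟦T⟧ ⊆ (L)`),
  `…_mem_charIdeal_of_thmD_OPEN` (the Kolyvagin direction in the CGLS sibling's currency, `k = 0`).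
* `thmE_pConverse_semistable_OPEN` — Theorem E (ONE new `Prop`); PROVED: `thmE_OPEN_iff_good_and_mult`,
  `thmE_good_half_of_thm012` (the good half is CONTAINED in the already-typed sequel fact — the new
  content is Cor. 5.2.2), `analyticRank_eq_of_thmE_OPEN_of_mult` /
  `_of_good`, `rank_eq_and_finite_sha_of_thmE_OPEN` (the printed "and so" clauses, via (GZK)),
  `analyticRank_eq_of_thmE_OPEN_of_mordellWeilRank_eq`, `thmE_CGLS_one_of_thmE_OPEN` /
  `thmE_CGLS_zero_of_thmE_OPEN` (contains the PUBLISHED Castella–Grossi–Lee–Skinner Thm. E).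

## References
* [KellerYin2024] arXiv:2402.12781v2: Thm. D (L306–L309) = Thm. 5.1.3 (L1771–L1780), §5.1 (a)–(e),
  Lemmas 5.1.1–5.1.2 (L1735–L1770), Remark after Thm. D (L311), §0.6 (L351–L353); Thm. E (L330–L338)
  = Thm. 4.1.1 (L1664–L1676) + Cor. 5.2.2 (L1794–L1805); Thm. 5.2.1 (L1783–L1792); §0.1 (L228,
  L233–L235); v1↔v2 numbering: tree `AnomalousBSD.lean` VERSION NOTE ("Thm. 4" = Thm. D).
* [CastellaGrossiLeeSkinner2022] Invent. Math. 227 (2022): proof of Thm. 4.2.2, Thm. 5.2.1 (layouts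
  copied: tree `IMC2DivisibilityAndBDPValueFrame.lean`, `PConverse.lean`). [Castella2018] Def. 2.2,
  Thm. 3.1 (objects at `p ∣ N`); [Castella2018Erratum] Thm. 1.1 (irreducible multiplicative sibling,
  tree `Castella2018/AnticyclotomicMainConjectureErratum.lean`). [Skinner2016PacificMC] §3.1;
  [Castella2020JIMJ] Thm. 2.11; [Kriz2016] Prop. 37; [Castella2024] Thms. 1.1, 3.4;
  [KellerYin2024PotOrd] Thm. 0.1.2 (tree `PotentiallyGoodOrdinaryPConverse.lean`). Gross–Zagier 1986 /
  Kolyvagin 1990: tree fact `rank_eq_analyticRank_of_analyticRank_le_one`.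
* Cell documents: `run/shared/lean/pub/bsd-littype/staging/bsd-littype-05/{LOCATOR,FAITHFULNESS}-05.md`,
  `run/shared/lean/pub/bsd-littype/OPEN-QUESTIONS-05.md`; TeX of record + PAGEMAP:
  `run/shared/lean/pub/bsd-eis/lit/src/ky24-v2/`.
-/

set_option autoImplicit false

noncomputable section

open scoped Classical

open PowerSeries WeierstrassCurve NumberField IsDedekindDomain Field
  Literature.NumberTheory.EllipticCurves Literature.NumberTheory.EllipticCurves.ModularForms
  Literature.NumberTheory.QuadraticFields Literature.NumberTheory.EllipticCurves.Rank1Residual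
  Literature.NumberTheory.EllipticCurves.Castella2018

namespace Literature.NumberTheory.EllipticCurves.KellerYin2024

/-! ### §1 Theorem D (= Thm. 5.1.3): the multiplicative anticyclotomic main conjecture — OPEN fact -/

section TheoremD

/-- **OPEN HYPOTHESIS — UNREFEREED PREPRINT (Keller–Yin, arXiv:2402.12781v2, Theorem D of the
Introduction = Theorem 5.1.3 `imc mult`; arXiv v1 "Theorem 4").** Verbatim (v2 TeX L306–L309):
"Let `f` be a newform of weight `2` and `p ‖ N` an odd Eisenstein prime of multiplicative reduction.
Let `K` be an imaginary quadratic field satisfying the hypotheses in §0.1 [a Heegner field for `N`: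
all primes dividing `N` split in `K`; `D_K` odd and `≠ −3`; `p = v v̄` splits in `K`]. Then the
following equation holds in `Λ^nr`: `Char(𝔛_f)Λ^nr = (𝓛_f)`." (Thm. 5.1.3: "`Char(𝔛_f)Λ^nr =
(𝓛_f) ⊆ Λ^nr`"; `𝔛_f = H¹_{𝓕_nr}(K, M_f)^∨` the unramified-Selmer dual of §5.1, `𝓛_f` the BDP
`p`-adic `L`-function.) TRANSCRIBED for an elliptic curve (`k = 2`, `ℤ[f] = ℤ`, `Λ = ℤ_p⟦T⟧`,
`Λ^nr = R₀⟦T⟧`; module docstring for the dictionary and the flags `KYD-Sel` / `KYD-frame` /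
`KYD-tors`): for `W/ℚ` globally minimal with newform `f` of level `N = N_W`, `2 < p`, `Mult W p`,
`Red W p`; `K` imaginary quadratic with (Heeg) for `N`, (disc), (spl); `v` induced by the embedding
datum `ι'`, `v̄ ∋ p` the other prime; `κ` anticyclotomic with topological generator `γ`: **there are
`Ω_K ≠ 0`, `Ω_p ∈ R₀ˣ`, `L ∈ R₀⟦T⟧` with `IsBDPLFunction ι' v κ γ f Ω_K Ω_p L` such that
`𝔛 = AcSelmer.XAc (W.baseChange K) p κ vbar ∅ γ` is `Λ`-torsion and, along THE structure map
`j : ℤ_p → R₀`, `Char_Λ(𝔛)·R₀⟦T⟧ = (L)`.** Printed proof (§5.1, L1735–L1780): Hida-family limit after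
[Ski14, §3.1] from Thm. 3.0.8 (IMC2) for the good members — with a located gap at L1754 (flag
`KYD-gap`, kernel counterexample `Summit.BirchSwinnertonDyer.Rank1Residual.X2.KellerYinFreePartGap`).
NEVER cite this `Prop` as a theorem: take it as an explicit hypothesis; a result using it is
conditional on an unrefereed, gapped-as-printed claim.
[claim: KellerYin2024, status: under-review]
[cite: Castella2018, Def. 2.2 (arXiv:1704.06608 p. 5) and Thm. 3.1 (p. 9) (the objects `X_ac`, `L_p(f)` at `p ∣ N`; shape only, nothing asserted)]
[cite: CastellaGrossiLeeSkinner2022, proof of Thm. 4.2.2 (TeX L2343–L2352) (the layout of the good-reduction sibling; shape only)] -/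
def thmD_imcMult_exists_isBDPLFunction_isTorsion_charIdeal_eq_OPEN : Prop :=
  ∀ {p : ℕ} [Fact p.Prime] (ι' : PadicAlgCl p ≃+* ℂ) (W : WeierstrassCurve ℚ) [W.IsElliptic]
    [W.IsGloballyMinimal] (K : Type) [Field K] [NumberField K] (v vbar : HeightOneSpectrum (𝓞 K))
    (κ : ZpExtension K p) (γ : absoluteGaloisGroup K) [Fact (κ.IsTopGenerator γ)] {N : ℕ} [NeZero N]
    {f : CuspForm (CongruenceSubgroup.Gamma0 N) 2} (_ : IsNewformOf W f),
    -- "`f` a newform of weight `2` [of level `N`] and `p ‖ N` an odd Eisenstein prime of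
    -- multiplicative reduction"
    W.conductorNorm ℤ = N → 2 < p → Mult W p → Red W p →
    -- "`K` … satisfying the hypotheses in §0.1": Heegner field for `N`, `D_K` odd `≠ -3`, `p` split
    IsImaginaryQuadratic K → SatisfiesHeegnerHypothesis N K →
      Odd (NumberField.discr K) → NumberField.discr K ≠ -3 →
      ((Ideal.span {(p : ℤ)}).primesOver (𝓞 K)).ncard = 2 →
    -- `p = v v̄`: `v` induced by `ι'`, `v̄` the other prime above `p`
    (∀ (w : InfinitePlace K) (k : 𝓞 K), k ∈ v.asIdeal ↔ ‖ι'.symm (w.embedding (k : K))‖ < 1) →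
      ((p : ℕ) : 𝓞 K) ∈ vbar.asIdeal → vbar ≠ v →
    -- `Λ = ℤ_p[[Γ]]`, `Γ = Gal(K_∞/K)` THE anticyclotomic `ℤ_p`-extension
    κ.IsAnticyclotomic →
    ∃ (ΩK : ℂ) (Ωp : (unrIntegers p)ˣ) (L : UnrSeries p),
      ΩK ≠ 0 ∧ IsBDPLFunction ι' v κ γ f ΩK ((Ωp : unrIntegers p) : ℂ_[p]) L ∧
      Module.IsTorsion (IwasawaAlgebra p) (AcSelmer.XAc (W.baseChange K) p κ vbar ∅ γ) ∧
      ∀ (j : ℤ_[p] →+* unrIntegers p),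
        (∀ x : ℤ_[p], ((j x : unrIntegers p) : ℂ_[p]) = algebraMap ℚ_[p] ℂ_[p] (x : ℚ_[p])) →
        (AcSelmer.XAc.charIdeal (W.baseChange K) p κ vbar ∅ γ).map (PowerSeries.map j) =
          Ideal.span {L}

end TheoremD

/-! ### §2 API for Theorem D (proved): the two one-sided forms -/

section TheoremDAPI

variable {p : ℕ} [Fact p.Prime] (ι' : PadicAlgCl p ≃+* ℂ) (W : WeierstrassCurve ℚ) [W.IsElliptic]
  [W.IsGloballyMinimal] (K : Type) [Field K] [NumberField K] (v vbar : HeightOneSpectrum (𝓞 K))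
  (κ : ZpExtension K p) (γ : absoluteGaloisGroup K) [Fact (κ.IsTopGenerator γ)] {N : ℕ} [NeZero N]
  {f : CuspForm (CongruenceSubgroup.Gamma0 N) 2} (hf : IsNewformOf W f)
  (hN : W.conductorNorm ℤ = N) (hp : 2 < p) (hmult : Mult W p) (hred : Red W p)
  (hK : IsImaginaryQuadratic K) (hHeeg : SatisfiesHeegnerHypothesis N K)
  (hodd : Odd (NumberField.discr K)) (hne : NumberField.discr K ≠ -3)
  (hsplit : ((Ideal.span {(p : ℤ)}).primesOver (𝓞 K)).ncard = 2)
  (hv : ∀ (w : InfinitePlace K) (k : 𝓞 K), k ∈ v.asIdeal ↔ ‖ι'.symm (w.embedding (k : K))‖ < 1)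
  (hvbar : ((p : ℕ) : 𝓞 K) ∈ vbar.asIdeal) (hvv : vbar ≠ v) (hκ : κ.IsAnticyclotomic)

include hf hN hp hmult hred hK hHeeg hodd hne hsplit hv hvbar hvv hκ

/-- **The one-sided divisibility `Char(𝔛_f)·Λ^nr ⊆ (𝓛_f)` from the OPEN equality** (the `p`-adic
`L`-function divides the characteristic series — the direction a Hida-limit argument produces,
cf. Castella's erratum (2.5)); same binders, conclusion with `≤` in place of `=` (`le_of_eq`).
CONDITIONAL on the OPEN fact; nothing asserted. [claim: KellerYin2024, status: under-review] -/
theorem exists_isBDPLFunction_isTorsion_charIdeal_le_of_thmD_OPEN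
    (h : thmD_imcMult_exists_isBDPLFunction_isTorsion_charIdeal_eq_OPEN) :
    ∃ (ΩK : ℂ) (Ωp : (unrIntegers p)ˣ) (L : UnrSeries p),
      ΩK ≠ 0 ∧ IsBDPLFunction ι' v κ γ f ΩK ((Ωp : unrIntegers p) : ℂ_[p]) L ∧
      Module.IsTorsion (IwasawaAlgebra p) (AcSelmer.XAc (W.baseChange K) p κ vbar ∅ γ) ∧
      ∀ (j : ℤ_[p] →+* unrIntegers p),
        (∀ x : ℤ_[p], ((j x : unrIntegers p) : ℂ_[p]) = algebraMap ℚ_[p] ℂ_[p] (x : ℚ_[p])) →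
        (AcSelmer.XAc.charIdeal (W.baseChange K) p κ vbar ∅ γ).map (PowerSeries.map j) ≤
          Ideal.span {L} := by
  obtain ⟨ΩK, Ωp, L, hΩ, hL, hT, hEq⟩ :=
    h ι' W K v vbar κ γ hf hN hp hmult hred hK hHeeg hodd hne hsplit hv hvbar hvv hκ
  exact ⟨ΩK, Ωp, L, hΩ, hL, hT, fun j hj ↦ le_of_eq (hEq j hj)⟩

/-- **The Kolyvagin direction `(𝓛_f) ⊆ Char(𝔛_f)·Λ^nr` from the OPEN equality, in the currency of
the good-reduction sibling `CastellaGrossiLeeSkinner2022.proofThm422_…_charIdeal_dvd`** ("`p^k · L ∈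
Char_Λ(𝔛)·R₀⟦T⟧` for some `k`", here with `k = 0`): at an X2 pair (`p ‖ N`, `E[p]` reducible) the
claim delivers exactly the shape CGLS print at `p ∤ N`. CONDITIONAL on the OPEN fact; nothing
asserted. [claim: KellerYin2024, status: under-review] -/
theorem exists_isBDPLFunction_isTorsion_mem_charIdeal_of_thmD_OPEN
    (h : thmD_imcMult_exists_isBDPLFunction_isTorsion_charIdeal_eq_OPEN) :
    ∃ (ΩK : ℂ) (Ωp : (unrIntegers p)ˣ) (L : UnrSeries p),
      ΩK ≠ 0 ∧ IsBDPLFunction ι' v κ γ f ΩK ((Ωp : unrIntegers p) : ℂ_[p]) L ∧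
      Module.IsTorsion (IwasawaAlgebra p) (AcSelmer.XAc (W.baseChange K) p κ vbar ∅ γ) ∧
      ∀ (j : ℤ_[p] →+* unrIntegers p),
        (∀ x : ℤ_[p], ((j x : unrIntegers p) : ℂ_[p]) = algebraMap ℚ_[p] ℂ_[p] (x : ℚ_[p])) →
        ∃ k : ℕ, C ((p : unrIntegers p) ^ k) * L ∈
          (AcSelmer.XAc.charIdeal (W.baseChange K) p κ vbar ∅ γ).map (PowerSeries.map j) := by
  obtain ⟨ΩK, Ωp, L, hΩ, hL, hT, hEq⟩ :=
    h ι' W K v vbar κ γ hf hN hp hmult hred hK hHeeg hodd hne hsplit hv hvbar hvv hκ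
  refine ⟨ΩK, Ωp, L, hΩ, hL, hT, fun j hj ↦ ⟨0, ?_⟩⟩
  rw [hEq j hj, pow_zero, map_one, one_mul]
  exact Ideal.mem_span_singleton_self L

end TheoremDAPI

/-! ### §3 Theorem E (= Thm. 4.1.1 + Cor. 5.2.2): the `p`-converse at a semistable Eisenstein prime — OPEN fact -/

section TheoremE

/-- **OPEN HYPOTHESIS — UNREFEREED PREPRINT (Keller–Yin, arXiv:2402.12781v2, Theorem E of the
Introduction = Theorem 4.1.1 `p converse` (good reduction) + Corollary 5.2.2 `p converse mult`
(multiplicative reduction)).** Verbatim (v2 TeX L330–L338): "Let `A/ℚ` be a simple RM abelian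
variety associated to a newform `f` and `𝔓 ∣ p > 2` a prime ideal of its endomorphism ring `𝒪` of
good ordinary or bad multiplicative reduction such that `ρ_{A,𝔓}` is reducible. Then
`corank_𝒪 Sel_{𝔓^∞}(A/ℚ) = r ∈ {0,1} ⟹ rk_𝒪 A(ℚ) = r_an(f) = r`, and `Ш(A/ℚ)[𝔓^∞]` is finite."
(Thm. 4.1.1: "… of good reduction such that `ρ_{A,𝔓}` is reducible"; Cor. 5.2.2: "… of
multiplicative reduction …".) TRANSCRIBED for `A = E` an elliptic curve over `ℚ` (`𝒪 = ℤ`,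
`𝔓 = (p)`; module docstring): `W/ℚ` globally minimal, `2 < p`, `Good W p ∨ Mult W p` (semistable
at `p`; good Eisenstein `p > 2` is ordinary, tree theorem `goodOrd_of_red_of_good`), `Red W p`
("`ρ_{A,𝔓}` reducible" = the paper's standing "Eisenstein": RESIDUALLY reducible), `r = 0 ∨ r = 1`,
`W.selmerCorank p = r`; conclusion `W.analyticRank = r` (the clauses `rk E(ℚ) = r`, `Ш[p^∞]`
finite are Gross–Zagier–Kolyvagin on top, proved below as `rank_eq_and_finite_sha_of_thmE_OPEN`).
No non-anomaly, image, conductor, CM, parity or Tamagawa hypothesis is printed, none is added. The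
GOOD half is contained in the sequel's typed claim `thm012_analyticRank_eq_of_selmerCorank_eq`
(arXiv:2410.23241 Thm. 0.1.2; theorem `thmE_good_half_of_thm012`); the MULTIPLICATIVE half
(Cor. 5.2.2) is new to the tree, its printed proof resting on Castella arXiv:2409.01360 (preprint)
and Thm. 5.2.1 (flag `KYE-Cas24`). NEVER cite this `Prop` as a theorem: take it as an explicit
hypothesis; a result using it is conditional on an unrefereed claim.
[claim: KellerYin2024, status: under-review] -/
def thmE_pConverse_semistable_OPEN : Prop :=
  ∀ (W : WeierstrassCurve ℚ) [W.IsElliptic] [W.IsGloballyMinimal] (p : ℕ) [Fact p.Prime],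
    2 < p → (Good W p ∨ Mult W p) → Red W p →
      ∀ r : ℕ, r = 0 ∨ r = 1 → W.selmerCorank p = r → W.analyticRank = r

end TheoremE

/-! ### §4 API for Theorem E (proved) -/

section TheoremEAPI

variable {W : WeierstrassCurve ℚ} {p : ℕ} [Fact p.Prime]

/-- **Theorem E = (Thm. 4.1.1 for `E/ℚ`) ∧ (Cor. 5.2.2 for `E/ℚ`)**: the fact is literally the
conjunction of its good-reduction half and its multiplicative half (both spelled out; no new name is
introduced for either). [claim: KellerYin2024, status: under-review] -/
theorem thmE_OPEN_iff_good_and_mult :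
    thmE_pConverse_semistable_OPEN ↔
      (∀ (W : WeierstrassCurve ℚ) [W.IsElliptic] [W.IsGloballyMinimal] (p : ℕ) [Fact p.Prime],
        2 < p → Good W p → Red W p →
          ∀ r : ℕ, r = 0 ∨ r = 1 → W.selmerCorank p = r → W.analyticRank = r) ∧
      (∀ (W : WeierstrassCurve ℚ) [W.IsElliptic] [W.IsGloballyMinimal] (p : ℕ) [Fact p.Prime],
        2 < p → Mult W p → Red W p →
          ∀ r : ℕ, r = 0 ∨ r = 1 → W.selmerCorank p = r → W.analyticRank = r) := by
  constructor
  · intro h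
    exact ⟨fun W _ _ p _ hp hg hred r hr hc ↦ h W p hp (Or.inl hg) hred r hr hc,
      fun W _ _ p _ hp hm hred r hr hc ↦ h W p hp (Or.inr hm) hred r hr hc⟩
  · rintro ⟨hg, hm⟩ W _ _ p _ hp hgm hred r hr hc
    rcases hgm with h | h
    · exact hg W p hp h hred r hr hc
    · exact hm W p hp h hred r hr hc

/-- **The good-reduction half of Theorem E (= Thm. 4.1.1 for `E/ℚ`) is contained in the sequel's
Thm. 0.1.2** (arXiv:2410.23241, tree `thm012_analyticRank_eq_of_selmerCorank_eq`, potentially good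
ORDINARY reduction): a good Eisenstein prime `p > 2` is ordinary (tree theorem
`hasPotentiallyGoodOrdinaryReductionAtPrime_of_red_of_good`, Serre 1972 §1.11). So the only content
of `thmE_pConverse_semistable_OPEN` not already typed is Cor. 5.2.2.
[claim: KellerYin2024PotOrd, status: under-review] -/
theorem thmE_good_half_of_thm012 (h : thm012_analyticRank_eq_of_selmerCorank_eq) :
    ∀ (W : WeierstrassCurve ℚ) [W.IsElliptic] [W.IsGloballyMinimal] (p : ℕ) [Fact p.Prime],
      2 < p → Good W p → Red W p →
        ∀ r : ℕ, r = 0 ∨ r = 1 → W.selmerCorank p = r → W.analyticRank = r :=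
  fun _ _ _ _ _ hp hgood hred _ hr hcork ↦ analyticRank_eq_of_thm012_of_good h hp hgood hred hr hcork

/-- **Cor. 5.2.2 for `E/ℚ`, consumer shape**: `2 < p`, `p ‖ N` (`Mult W p`), `E[p]` reducible,
`corank_{ℤ_p} Sel_{p^∞}(E/ℚ) = r ∈ {0,1}` ⇒ `ord_{s=1} L(E,s) = r` — the class-X2 `p`-converse.
[claim: KellerYin2024, status: under-review] -/
theorem analyticRank_eq_of_thmE_OPEN_of_mult [W.IsElliptic] [W.IsGloballyMinimal]
    (h : thmE_pConverse_semistable_OPEN) (hp : 2 < p) (hmult : Mult W p) (hred : Red W p)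
    {r : ℕ} (hr : r = 0 ∨ r = 1) (hcork : W.selmerCorank p = r) : W.analyticRank = r :=
  h W p hp (Or.inr hmult) hred r hr hcork

/-- **Thm. 4.1.1 for `E/ℚ`, consumer shape**: `2 < p` good, `E[p]` reducible (anomalous allowed),
`corank_{ℤ_p} Sel_{p^∞}(E/ℚ) = r ∈ {0,1}` ⇒ `ord_{s=1} L(E,s) = r`.
[claim: KellerYin2024, status: under-review] -/
theorem analyticRank_eq_of_thmE_OPEN_of_good [W.IsElliptic] [W.IsGloballyMinimal]
    (h : thmE_pConverse_semistable_OPEN) (hp : 2 < p) (hgood : Good W p) (hred : Red W p)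
    {r : ℕ} (hr : r = 0 ∨ r = 1) (hcork : W.selmerCorank p = r) : W.analyticRank = r :=
  h W p hp (Or.inl hgood) hred r hr hcork

/-- **Theorem E, full printed conclusion** for `E/ℚ`: under its hypotheses, `corank_{ℤ_p}
Sel_{p^∞}(E/ℚ) = r` (`r ∈ {0,1}`) gives `r_an(E) = r` (the fact) and then "`rk_ℤ E(ℚ) = r`" and
"`Ш(E/ℚ)[p^∞]` is finite" (indeed all of `Ш(E/ℚ)` is finite) — by Gross–Zagier–Kolyvagin (`hGZK`,
the tree's named fact bsd.S17, fed exactly as in the sibling `p`-converse files).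
[claim: KellerYin2024, status: under-review] -/
theorem rank_eq_and_finite_sha_of_thmE_OPEN [W.IsElliptic] [W.IsGloballyMinimal]
    (h : thmE_pConverse_semistable_OPEN) (hGZK : rank_eq_analyticRank_of_analyticRank_le_one)
    (hp : 2 < p) (hsemi : Good W p ∨ Mult W p) (hred : Red W p)
    {r : ℕ} (hr : r = 0 ∨ r = 1) (hcork : W.selmerCorank p = r) :
    W.analyticRank = r ∧ W.mordellWeilRank = r ∧ Finite W.sha := by
  have hra : W.analyticRank = r := h W p hp hsemi hred r hr hcork
  obtain ⟨hrk, hfin⟩ := hGZK W (by rcases hr with rfl | rfl <;> omega)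
  exact ⟨hra, hrk.trans hra, hfin⟩

/-- **Rank form at a semistable Eisenstein prime**: `rk_ℤ E(ℚ) = r ∈ {0,1}` and `Ш(E/ℚ)[p^∞]`
finite give `corank_{ℤ_p} Sel_{p^∞}(E/ℚ) = r` (tree THEOREM `corank Sel_{p^∞} = rank + corank
Ш[p^∞]`, `selmerCorank_eq_mordellWeilRank_of_finite_shaPrimary`), whence `r_an(E) = r` by the fact.
[claim: KellerYin2024, status: under-review] -/
theorem analyticRank_eq_of_thmE_OPEN_of_mordellWeilRank_eq [W.IsElliptic] [W.IsGloballyMinimal]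
    (h : thmE_pConverse_semistable_OPEN) (hp : 2 < p) (hsemi : Good W p ∨ Mult W p) (hred : Red W p)
    {r : ℕ} (hr : r = 0 ∨ r = 1) (hrank : W.mordellWeilRank = r)
    (hsha : Finite (AddCommGroup.primaryComponent W.sha p)) : W.analyticRank = r :=
  h W p hp hsemi hred r hr
    ((selmerCorank_eq_mordellWeilRank_of_finite_shaPrimary W p hsha).trans hrank)

/-- **Theorem E contains the PUBLISHED Castella–Grossi–Lee–Skinner 2022 Thm. E, case `r = 1`**
(`CastellaGrossiLeeSkinner2022.thmE_analyticRank_eq_one_of_selmerCorank_eq_one`: good Eisenstein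
`p > 2`, NON-anomalous — the non-anomaly hypothesis is simply not used; §0.6: "direct
generalizations of those in [CGLS] … while removing the technical condition `θ|_{G_p} ≠ 1, ω`").
[claim: KellerYin2024, status: under-review] -/
theorem thmE_CGLS_one_of_thmE_OPEN (h : thmE_pConverse_semistable_OPEN) :
    CastellaGrossiLeeSkinner2022.thmE_analyticRank_eq_one_of_selmerCorank_eq_one := by
  intro W _ _ p _ hp hgood hred _ hcork
  exact analyticRank_eq_of_thmE_OPEN_of_good h hp hgood hred (Or.inr rfl) hcork

/-- **Theorem E contains the PUBLISHED Castella–Grossi–Lee–Skinner 2022 Thm. E, case `r = 0`**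
(`CastellaGrossiLeeSkinner2022.thmE_analyticRank_eq_zero_of_selmerCorank_eq_zero`).
[claim: KellerYin2024, status: under-review] -/
theorem thmE_CGLS_zero_of_thmE_OPEN (h : thmE_pConverse_semistable_OPEN) :
    CastellaGrossiLeeSkinner2022.thmE_analyticRank_eq_zero_of_selmerCorank_eq_zero := by
  intro W _ _ p _ hp hgood hred _ hcork
  exact analyticRank_eq_of_thmE_OPEN_of_good h hp hgood hred (Or.inl rfl) hcork

end TheoremEAPI

end Literature.NumberTheory.EllipticCurves.KellerYin2024

end
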